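import Summits.CriticalPhenomena.PercolationContinuityZ3.Theorems.PercNearOneGluingNoHeavyLowerTailSuperTerminalP3LamGluing
import Summits.CriticalPhenomena.PercolationContinuityZ3.Theorems.PercNearOneGluingNoHeavyLowerTailSuperTerminalQuarticPendant
import HarnessLib

/-!
# Port trees: rows that are piece-stable, pendant-stable and trivial at an isolated port hold whenever the port component is a tree (test file)
-/

namespace Summit.CriticalPhenomena.PercolationContinuityZ3.Theorems.SuperTerminalPortTree

open MeasureTheory Set
open Literature.Probability.Percolation Literature.Probability.Percolation.PartitionGluing
open Literature.Probability.LatticeModels (prodBernoulli)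
open scoped Classical

variable {V : Type*}

/-! ## Rooted-tree certificates: parent map and rank -/

section Tree

variable {K : Finset V} {par : V → V} {rk : V → ℕ} {c : V}

/-- In a rooted-tree certificate, rank `0` characterises the root. [folklore] -/
theorem eq_root_of_rk_eq_zero (hpar : ∀ v ∈ K, v ≠ c → par v ∈ K ∧ rk v = rk (par v) + 1)
    {v : V} (hv : v ∈ K) (h0 : rk v = 0) : v = c := by
  by_contra hvc
  have := (hpar v hv hvc).2
  omega

/-- The `n`-fold parent of a vertex of rank `n+1` is a child of the root. [folklore] -/
theorem iterate_par_spec (hrc : rk c = 0) (hpar : ∀ v ∈ K, v ≠ c → par v ∈ K ∧ rk v = rk (par v) + 1) :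
    ∀ n : ℕ, ∀ v ∈ K, rk v = n + 1 → par^[n] v ∈ K ∧ par (par^[n] v) = c ∧ rk (par^[n] v) = 1 := by
  intro n
  induction n with
  | zero =>
    intro v hv h1
    have hvc : v ≠ c := fun h => by subst h; omega
    obtain ⟨hp, hr⟩ := hpar v hv hvc
    refine ⟨by simpa using hv, ?_, by simpa using h1⟩
    simp only [Function.iterate_zero, id_eq]
    exact eq_root_of_rk_eq_zero hpar hp (by omega)
  | succ n ih =>
    intro v hv h2
    have hvc : v ≠ c := fun h => by subst h; omega
    obtain ⟨hp, hr⟩ := hpar v hv hvc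
    have := ih (par v) hp (by omega)
    simpa only [Function.iterate_succ_apply] using this

/-- The ancestor of `v` among the children of the root: `par^[rk v − 1] v`. -/
theorem anc_spec (hrc : rk c = 0) (hpar : ∀ v ∈ K, v ≠ c → par v ∈ K ∧ rk v = rk (par v) + 1)
    {v : V} (hv : v ∈ K) (hvc : v ≠ c) :
    par^[rk v - 1] v ∈ K ∧ par (par^[rk v - 1] v) = c ∧ rk (par^[rk v - 1] v) = 1 := by
  have h1 : rk v = (rk v - 1) + 1 := by have := (hpar v hv hvc).2; omega
  exact iterate_par_spec hrc hpar (rk v - 1) v hv h1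

/-- A vertex and its (non-root) parent have the same ancestor among the children of the root. [folklore] -/
theorem anc_par (hpar : ∀ v ∈ K, v ≠ c → par v ∈ K ∧ rk v = rk (par v) + 1)
    {v : V} (hv : v ∈ K) (hvc : v ≠ c) (hpc : par v ≠ c) :
    par^[rk (par v) - 1] (par v) = par^[rk v - 1] v := by
  obtain ⟨hp, hr⟩ := hpar v hv hvc
  have h1 : 1 ≤ rk (par v) := by
    have := (hpar (par v) hp hpc).2; omega
  have : rk v - 1 = (rk (par v) - 1) + 1 := by omega
  rw [this, Function.iterate_succ_apply]

end Tree

variable [Fintype V]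

/-! ## The abstract port-tree theorem -/

/-- **Port-tree induction.**  Let `R w c` be a property of a weight `w` and a port `c` (the terminals `s a b` being fixed) which is
(i) stable under splitting along `{s,a,b,c}` (`hpieces`, the shape of `…Gluing.*_of_pieces` with pieces labelled by vertices),
(ii) stable along a pendant port (`hpend`, the shape of `SuperTerminalQuarticPendant.*_pendant`), and (iii) true at an isolated port (`hiso`).
Then `R w c` holds whenever the port component admits a ROOTED-TREE CERTIFICATE `(K, par, rk)`: `c ∈ K ⊆ V ∖ {s,a,b}`, `rk c = 0`, every
`v ∈ K ∖ {c}` has its parent in `K` one rank lower, and every positive pair from `K` to a non-terminal vertex is a parent pair inside `K`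
(so the positive non-terminal pairs at `K` form a subforest of the tree and no positive pair leaves `K` except to `s, a, b`).
Proof: induction on `|K|`; split along `{s,a,b,c}` with the pieces 'subtree below the child `x`' (label `some x`) and 'everything outside
`K`' (label `c`); in the piece of a child the port is pendant, and after detaching it the child is the port of a smaller certificate. [this work] -/
theorem row_of_portTree (R : (Sym2 V → unitInterval) → V → Prop) {s a b : V}
    (hpieces : ∀ (w : Sym2 V → unitInterval) (c : V), s ≠ a → s ≠ b → s ≠ c → a ≠ b → a ≠ c → b ≠ c →
      ∀ part : V → V,
        (∀ x y : V, x ∉ ({s, a, b, c} : Finset V) → y ∉ ({s, a, b, c} : Finset V) → part x ≠ part y → (w s(x, y) : ℝ) = 0) →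
        (∀ i : V, R (fun e => if e ∈ piecePairs {s, a, b, c} part i then w e else 0) c) → R w c)
    (hpend : ∀ (w : Sym2 V → unitInterval) (c x : V), s ≠ c → a ≠ c → b ≠ c → x ≠ c →
      (∀ y, y ≠ c → y ≠ x → (w s(c, y) : ℝ) = 0) → R (Function.update w s(c, x) 0) x → R w c)
    (hiso : ∀ (w : Sym2 V → unitInterval) (c : V), s ≠ c → a ≠ c → b ≠ c → (∀ y, y ≠ c → (w s(c, y) : ℝ) = 0) → R w c)
    (hsa : s ≠ a) (hsb : s ≠ b) (hab : a ≠ b)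
    (w : Sym2 V → unitInterval) (c : V) (K : Finset V) (par : V → V) (rk : V → ℕ)
    (hcK : c ∈ K) (hKT : ∀ v ∈ K, v ≠ s ∧ v ≠ a ∧ v ≠ b) (hrc : rk c = 0)
    (hpar : ∀ v ∈ K, v ≠ c → par v ∈ K ∧ rk v = rk (par v) + 1)
    (hclosed : ∀ x ∈ K, ∀ y : V, y ≠ s → y ≠ a → y ≠ b → y ≠ x → (0 : ℝ) < w s(x, y) →
      y ∈ K ∧ ((par x = y ∧ rk x = rk y + 1) ∨ (par y = x ∧ rk y = rk x + 1))) :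
    R w c := by
  suffices H : ∀ (n : ℕ) (w : Sym2 V → unitInterval) (c : V) (K : Finset V) (par : V → V) (rk : V → ℕ), K.card = n →
      c ∈ K → (∀ v ∈ K, v ≠ s ∧ v ≠ a ∧ v ≠ b) → rk c = 0 → (∀ v ∈ K, v ≠ c → par v ∈ K ∧ rk v = rk (par v) + 1) →
      (∀ x ∈ K, ∀ y : V, y ≠ s → y ≠ a → y ≠ b → y ≠ x → (0 : ℝ) < w s(x, y) →
        y ∈ K ∧ ((par x = y ∧ rk x = rk y + 1) ∨ (par y = x ∧ rk y = rk x + 1))) → R w c from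
    H _ w c K par rk rfl hcK hKT hrc hpar hclosed
  intro n
  induction n using Nat.strong_induction_on with
  | _ n IH =>
  intro w c K par rk hn hcK hKT hrc hpar hclosed
  obtain ⟨hcs, hca, hcb⟩ := hKT c hcK
  -- the ancestor among the children of `c`
  set anc : V → V := fun v => par^[rk v - 1] v with hanc
  -- the labelling: subtree below each child; the label `c` for everything outside `K ∖ {c}` (terminals belong to no piece)
  set part : V → V := fun v => if v ∈ K ∧ v ≠ c then anc v else c with hpart
  -- weights are nonnegative; `≠ 0` means `> 0`
  have pos_of_ne : ∀ e : Sym2 V, (w e : ℝ) ≠ 0 → (0 : ℝ) < w e := fun e he => lt_of_le_of_ne (w e).2.1 (Ne.symm he)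
  -- cross-label pairs have weight zero
  have hcross : ∀ x y : V, x ∉ ({s, a, b, c} : Finset V) → y ∉ ({s, a, b, c} : Finset V) → part x ≠ part y → (w s(x, y) : ℝ) = 0 := by
    intro x y hx hy hne
    simp only [Finset.mem_insert, Finset.mem_singleton, not_or] at hx hy
    by_contra h
    have hpos := pos_of_ne _ h
    have hxy : x ≠ y := by rintro rfl; exact hne rfl
    by_cases hxK : x ∈ K
    · obtain ⟨hyK, hrel⟩ := hclosed x hxK y hy.1 hy.2.1 hy.2.2.1 hxy.symm hpos
      apply hne
      simp only [hpart, hxK, hx.2.2.2, hyK, hy.2.2.2, ne_eq, not_false_eq_true, and_self, ite_true]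
      rcases hrel with ⟨hpxy, -⟩ | ⟨hpyx, -⟩
      · -- `y = par x`
        have := anc_par hpar hxK hx.2.2.2 (by rw [hpxy]; exact hy.2.2.2)
        rw [hpxy] at this
        simp only [hanc]; rw [this]
      · have := anc_par hpar hyK hy.2.2.2 (by rw [hpyx]; exact hx.2.2.2)
        rw [hpyx] at this
        simp only [hanc]; rw [this]
    · have hyK : y ∉ K := by
        intro hyK
        have hpos' : (0 : ℝ) < w s(y, x) := by rw [Sym2.eq_swap]; exact hpos
        exact hxK (hclosed y hyK x hx.1 hx.2.1 hx.2.2.1 hxy hpos').1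
      apply hne
      simp only [hpart, hxK, hyK, false_and, ite_false]
  -- a positive pair at the port goes to a child `y`, and `part y = y`
  have port_pair : ∀ y : V, y ≠ s → y ≠ a → y ≠ b → y ≠ c → (0 : ℝ) < w s(c, y) →
      y ∈ K ∧ par y = c ∧ rk y = 1 ∧ part y = y := by
    intro y hys hya hyb hyc hpos
    obtain ⟨hyK, hrel⟩ := hclosed c hcK y hys hya hyb hyc hpos
    rcases hrel with ⟨-, h⟩ | ⟨hpy, hry⟩
    · omega
    · have hr1 : rk y = 1 := by omega
      refine ⟨hyK, hpy, hr1, ?_⟩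
      simp only [hpart, hyK, hyc, ne_eq, not_false_eq_true, and_self, ite_true, hanc, hr1]
      simp
  -- membership of a port pair in a piece forces the label of the far end
  have mem_port : ∀ (i : V) (y : V), s(c, y) ∈ piecePairs ({s, a, b, c} : Finset V) part i →
      y ∉ ({s, a, b, c} : Finset V) ∧ part y = i := by
    intro i y hmem
    obtain ⟨u, v, ⟨hu, hui⟩, hv, huv, he⟩ := mem_piecePairs.1 hmem
    have hcT : c ∈ ({s, a, b, c} : Finset V) := by simp
    rcases Sym2.eq_iff.1 he with ⟨h1, h2⟩ | ⟨h1, h2⟩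
    · exact absurd hcT (h1 ▸ hu)
    · subst h2; exact ⟨hu, hui⟩
  -- apply piece-stability
  refine hpieces w c hsa hsb hcs.symm hab hca.symm hcb.symm part hcross fun i => ?_
  -- the piece weight
  set wi : Sym2 V → unitInterval := fun e => if e ∈ piecePairs ({s, a, b, c} : Finset V) part i then w e else 0 with hwi
  by_cases hchild : i ∈ K ∧ par i = c ∧ rk i = 1
  · obtain ⟨hx0K, hpx0, hrx0⟩ := hchild
    set x0 := i with hx0i
    obtain ⟨hx0s, hx0a, hx0b⟩ := hKT x0 hx0K
    have hx0c : x0 ≠ c := fun h => by subst h; omega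
    have hanc0 : anc x0 = x0 := by simp [hanc, hrx0]
    -- in this piece the port `c` is pendant to `x0`
    have hpendi : ∀ y, y ≠ c → y ≠ x0 → (wi s(c, y) : ℝ) = 0 := by
      intro y hyc hyx0
      simp only [hwi]
      split_ifs with hmem
      · obtain ⟨hyT, hpy⟩ := mem_port _ y hmem
        simp only [Finset.mem_insert, Finset.mem_singleton, not_or] at hyT
        by_contra h
        obtain ⟨-, -, -, hpy'⟩ := port_pair y hyT.1 hyT.2.1 hyT.2.2.1 hyc (pos_of_ne _ h)
        rw [hpy'] at hpy
        exact hyx0 hpy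
      · rfl
    refine hpend wi c x0 hcs.symm hca.symm hcb.symm hx0c hpendi ?_
    -- the detached piece: port `x0`, certificate = the subtree below `x0`
    set K' : Finset V := K.filter fun v => v ≠ c ∧ anc v = x0 with hK'
    have hK'sub : K' ⊆ K := Finset.filter_subset _ _
    have hcK' : c ∉ K' := by simp [hK']
    have hcard : K'.card < n := by
      rw [← hn]
      exact Finset.card_lt_card ⟨hK'sub, fun h => hcK' (h hcK)⟩
    have hx0K' : x0 ∈ K' := by simp [hK', hx0K, hx0c, hanc0]
    refine IH K'.card hcard (Function.update wi s(c, x0) 0) x0 K' par (fun v => rk v - 1) rfl hx0K'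
      (fun v hv => hKT v (hK'sub hv)) (by simp [hrx0]) ?_ ?_
    · -- parent structure inside `K'`
      intro v hv hvx0
      simp only [hK', Finset.mem_filter] at hv
      obtain ⟨hvK, hvc, hav⟩ := hv
      obtain ⟨hpK, hrv⟩ := hpar v hvK hvc
      have hr2 : 2 ≤ rk v := by
        by_contra hlt
        have hr1 : rk v = 1 := by omega
        apply hvx0
        have : anc v = v := by simp [hanc, hr1]
        rw [← hav, this]
      have hpc : par v ≠ c := fun h => by rw [h, hrc] at hrv; omega
      refine ⟨?_, by omega⟩
      simp only [hK', Finset.mem_filter]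
      refine ⟨hpK, hpc, ?_⟩
      have := anc_par hpar hvK hvc hpc
      simp only [hanc] at hav ⊢
      rw [this, hav]
    · -- closure of `K'` under positive non-terminal pairs of the detached piece
      intro x hx y hys hya hyb hyx hpos
      simp only [hK', Finset.mem_filter] at hx
      obtain ⟨hxK, hxc, hax⟩ := hx
      -- the pair is not `cx0` and has positive `w`-weight
      have hne : s(x, y) ≠ s(c, x0) := by
        intro h
        rw [h, Function.update_self] at hpos
        simp at hpos
      rw [Function.update_of_ne hne] at hpos
      have hposw : (0 : ℝ) < w s(x, y) := by
        simp only [hwi] at hpos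
        split_ifs at hpos with hmem
        · exact hpos
        · simp at hpos
      obtain ⟨hyK, hrel⟩ := hclosed x hxK y hys hya hyb hyx hposw
      have hyc : y ≠ c := by
        rintro rfl
        rcases hrel with ⟨hpx, hrx⟩ | ⟨-, h⟩
        · -- `x` is a child with ancestor `x0`, hence `x = x0`: the pair is `cx0`
          have hr1 : rk x = 1 := by omega
          have : anc x = x := by simp [hanc, hr1]
          apply hne
          rw [← hax, this, Sym2.eq_swap]
        · omega
      have hay : anc y = x0 := by
        rcases hrel with ⟨hpxy, -⟩ | ⟨hpyx, -⟩
        · have := anc_par hpar hxK hxc (by rw [hpxy]; exact hyc)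
          rw [hpxy] at this
          simp only [hanc] at hax ⊢
          rw [this, hax]
        · have := anc_par hpar hyK hyc (by rw [hpyx]; exact hxc)
          rw [hpyx] at this
          simp only [hanc] at hax ⊢
          rw [← this, hax]
      have hyK' : y ∈ K' := by simp [hK', hyK, hyc, hay]
      refine ⟨hyK', ?_⟩
      have hx1 : 1 ≤ rk x := by have := (hpar x hxK hxc).2; omega
      have hy1 : 1 ≤ rk y := by have := (hpar y hyK hyc).2; omega
      rcases hrel with ⟨hp, hr⟩ | ⟨hp, hr⟩
      · left; exact ⟨hp, by omega⟩
      · right; exact ⟨hp, by omega⟩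
  · -- no child carries this label: the port is isolated in the piece
    refine hiso wi c hcs.symm hca.symm hcb.symm fun y hyc => ?_
    simp only [hwi]
    split_ifs with hmem
    · obtain ⟨hyT, hpy⟩ := mem_port _ y hmem
      simp only [Finset.mem_insert, Finset.mem_singleton, not_or] at hyT
      by_contra h
      obtain ⟨hyK, hpyc, hry, hpy'⟩ := port_pair y hyT.1 hyT.2.1 hyT.2.2.1 hyc (pos_of_ne _ h)
      have hiy : i = y := by rw [← hpy, hpy']
      exact hchild (hiy ▸ ⟨hyK, hpyc, hry⟩)
    · rfl

/-! ## Instances: the reverse-Harris rows `P3_λ` (`λ ≥ 8/5`), in particular `P3½`, on the port-tree class -/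

/-- **THEOREM T′.**  For every `λ ≥ 8/5`, the reverse-Harris row `P3_λ : μ(F)·μ(c ↔ T) ≤ λ·μ(F ∩ c↔T)` (`F = (s↔a)∩(s↔b)ᶜ`, `T = {s,a,b}`)
holds on every finite weighted graph whose port component admits a rooted-tree certificate (the positive non-terminal pairs at the component of
`c` in `G − {s,a,b}` form a tree; everything else — other components, terminal pairs, `c–T` pairs — arbitrary).  Ingredients: ∥-stability
`SuperTerminalP3LamGluing.p3lam_of_pieces` (l12-p1 g31/g32), the pendant transfer `SuperTerminalQuarticPendant.p3lam_pendant` and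
`p3lam_isolatedPort`, assembled by `row_of_portTree`. [this work] -/
theorem p3lam_of_portTree {lam : ℝ} (hlam : 8 / 5 ≤ lam) {s a b : V} (hsa : s ≠ a) (hsb : s ≠ b) (hab : a ≠ b)
    (w : Sym2 V → unitInterval) (c : V) (K : Finset V) (par : V → V) (rk : V → ℕ)
    (hcK : c ∈ K) (hKT : ∀ v ∈ K, v ≠ s ∧ v ≠ a ∧ v ≠ b) (hrc : rk c = 0)
    (hpar : ∀ v ∈ K, v ≠ c → par v ∈ K ∧ rk v = rk (par v) + 1)
    (hclosed : ∀ x ∈ K, ∀ y : V, y ≠ s → y ≠ a → y ≠ b → y ≠ x → (0 : ℝ) < w s(x, y) →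
      y ∈ K ∧ ((par x = y ∧ rk x = rk y + 1) ∨ (par y = x ∧ rk y = rk x + 1))) :
    (prodBernoulli w).real (openConn s a ∩ (openConn s b)ᶜ : Set (BondConfig V)) *
        (prodBernoulli w).real ((openConn c s)ᶜ ∩ (openConn c a)ᶜ ∩ (openConn c b)ᶜ : Set (BondConfig V))ᶜ ≤
      lam * (prodBernoulli w).real (openConn s a ∩ (openConn s b)ᶜ ∩ ((openConn c s)ᶜ ∩ (openConn c a)ᶜ ∩ (openConn c b)ᶜ)ᶜ : Set (BondConfig V)) := by
  refine row_of_portTree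
    (fun (w : Sym2 V → unitInterval) (c : V) =>
      (prodBernoulli w).real (openConn s a ∩ (openConn s b)ᶜ : Set (BondConfig V)) *
          (prodBernoulli w).real ((openConn c s)ᶜ ∩ (openConn c a)ᶜ ∩ (openConn c b)ᶜ : Set (BondConfig V))ᶜ ≤
        lam * (prodBernoulli w).real (openConn s a ∩ (openConn s b)ᶜ ∩ ((openConn c s)ᶜ ∩ (openConn c a)ᶜ ∩ (openConn c b)ᶜ)ᶜ : Set (BondConfig V)))
    ?_ ?_ ?_ hsa hsb hab w c K par rk hcK hKT hrc hpar hclosed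
  · intro w c hsa hsb hsc hab hac hbc part hw hrow
    exact SuperTerminalP3LamGluing.p3lam_of_pieces hlam w ⟨hsa, hsb, hsc, hab, hac, hbc⟩ part hw hrow
  · intro w c x hsc hac hbc hxc hpend h
    exact SuperTerminalQuarticPendant.p3lam_pendant w hsc hac hbc hxc hpend h
  · intro w c hsc hac hbc hiso
    exact SuperTerminalQuarticPendant.p3lam_isolatedPort w hsc hac hbc hiso (by linarith)

/-- **`P3½` on the port-tree class** (`λ = 2`): `μ(F)·μ(c ↔ T) ≤ 2·μ(F ∩ c↔T)` — the conclusion shape of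
`SuperTerminalQuarticFace.p3_half_of_superTerminalQuartic`, hence TCB′½ / TCB / TT-CHORD(E₃) on this class via the `IncStar` files. [this work] -/
theorem p3_half_of_portTree {s a b : V} (hsa : s ≠ a) (hsb : s ≠ b) (hab : a ≠ b)
    (w : Sym2 V → unitInterval) (c : V) (K : Finset V) (par : V → V) (rk : V → ℕ)
    (hcK : c ∈ K) (hKT : ∀ v ∈ K, v ≠ s ∧ v ≠ a ∧ v ≠ b) (hrc : rk c = 0)
    (hpar : ∀ v ∈ K, v ≠ c → par v ∈ K ∧ rk v = rk (par v) + 1)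
    (hclosed : ∀ x ∈ K, ∀ y : V, y ≠ s → y ≠ a → y ≠ b → y ≠ x → (0 : ℝ) < w s(x, y) →
      y ∈ K ∧ ((par x = y ∧ rk x = rk y + 1) ∨ (par y = x ∧ rk y = rk x + 1))) :
    (prodBernoulli w).real (openConn s a ∩ (openConn s b)ᶜ : Set (BondConfig V)) *
        (prodBernoulli w).real ((openConn c s)ᶜ ∩ (openConn c a)ᶜ ∩ (openConn c b)ᶜ : Set (BondConfig V))ᶜ ≤
      2 * (prodBernoulli w).real (openConn s a ∩ (openConn s b)ᶜ ∩ ((openConn c s)ᶜ ∩ (openConn c a)ᶜ ∩ (openConn c b)ᶜ)ᶜ : Set (BondConfig V)) :=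
  p3lam_of_portTree (by norm_num) hsa hsb hab w c K par rk hcK hKT hrc hpar hclosed

end Summit.CriticalPhenomena.PercolationContinuityZ3.Theorems.SuperTerminalPortTree
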